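import Literature.NumberTheory.GaloisRepresentations.ContinuousH1
import Literature.NumberTheory.GaloisRepresentations.ContinuousH2
import Literature.NumberTheory.GaloisRepresentations.GlobalTriangulineSpace
import Literature.NumberTheory.GaloisRepresentations.LabelledHodgeTateWeights
import HarnessLib

/-!
# Continuous `H¹` and `H²` do not see the ring of scalars

Topic `NumberTheory/GaloisRepresentations` (continuous cochain cohomology; Mathlib's
`continuousCohomology`); namespace `Literature.NumberTheory.GaloisRepresentations`. Theorems only;
no definition, no named fact, no `sorry`.

For a continuous representation `ρ : ContinuousRep G A M` of a topological group `G` on a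
topological `A`-module `M` and a ring of coefficients `P → A` (`ρ.restrictScalars P`, same maps, same
topology), the continuous cohomology carriers `Hⁱ(G, M)` computed over `A` and over `P` are a priori
different objects (homology in `TopModuleCat A`, resp. `TopModuleCat P`). In degrees `i = 1, 2` the
tree's element-level descriptions — continuous crossed homomorphisms (`ContinuousH1.lean`:
`oneCocycleClass_surjective`, `oneCocycleClass_eq_zero_iff`) and continuous inhomogeneous
`2`-cocycles (`ContinuousH2.lean`: `twoCocycleClass_surjective`, `twoCocycleClass_eq_zero_iff`) —
are statements about continuous functions `Gⁱ → M` and the action only, so VANISHING is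
independent of the scalars:

* `subsingleton_continuousCohomology_one_iff_forall_oneCocycle` /
  `subsingleton_continuousCohomology_two_iff_forall_twoCocycle` — `Hⁱ_cont(G, X) = 0` iff every
  continuous inhomogeneous `i`-cocycle is a continuous coboundary (`i = 1, 2`; `i = 2` for locally
  compact `G`);
* `ContinuousRep.subsingleton_H_one_restrictScalars_iff` /
  `ContinuousRep.subsingleton_H_two_restrictScalars_iff` — `Hⁱ(G, M|_P) = 0 ↔ Hⁱ(G, M) = 0`.

This is the continuous analogue (degrees `1`, `2`, vanishing form) of the tree's
`Literature.Algebra.Homology.GroupCohomologyRestrictScalars` ("group cohomology does not see the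
scalars", Brown III.1 Ex. 3) and is piece (D2) of the door recorded in ARM P sheet
`pub/bsd-cited/sheets/D-AUDIT-r13-S15-Gr06Thm3Shapiro.md` §3 (cell `bsd-eis` RULING L68 (1)): it lets
the Serre-side Shapiro theorems of `ShapiroVanishing.lean` (over `ℤ`) be applied to vanishing
statements for representations typed over `𝒪` or `Λ₂` (Greenberg 2006 Thm. 3 in degree `2`).
-- TODO(general form): all degrees `n`, and the comparison `Hⁿ(G, M|_P) ≃+ Hⁿ(G, M)` itself, by a
-- cochain-level comparison of Mathlib's `TopRep.resolutionX` over the two rings (induction on `n`).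

## References
* J.-P. Serre, *Galois Cohomology* (1997), I §2.2 (continuous cochains, `H¹`), I §2.3 (`H²` =
  classes of continuous factor systems). [SerreGaloisCohomology1997]
* K. S. Brown, *Cohomology of Groups* (1982), III.1 Example 3 (standard cochains do not involve the
  scalars). [Brown1982CohomologyGroups]
-/

noncomputable section

open CategoryTheory

namespace Literature.NumberTheory.GaloisRepresentations

universe u v

section Criterion

variable {R : Type u} [CommRing R] [TopologicalSpace R]
variable {G : Type v} [Group G] [TopologicalSpace G] [IsTopologicalGroup G]

/-- `H¹_cont(G, X) = 0` iff every continuous crossed homomorphism is principal.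
[cite: SerreGaloisCohomology1997, I §2.2] -/
theorem subsingleton_continuousCohomology_one_iff_forall_oneCocycle (X : TopRep.{v} R G) :
    Subsingleton (continuousCohomology 1 X) ↔
      ∀ φ : C(G, X), (∀ g h : G, φ (g * h) = φ g + X.ρ g (φ h)) →
        ∃ v : X, ∀ g : G, φ g = X.ρ g v - v := by
  constructor
  · intro h φ hφ
    have h0 : oneCocycleClass X ⟨φ, hφ⟩ = 0 := Subsingleton.elim _ _
    exact (oneCocycleClass_eq_zero_iff X ⟨φ, hφ⟩).1 h0
  · intro H
    refine ⟨fun a b => ?_⟩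
    obtain ⟨f, rfl⟩ := oneCocycleClass_surjective X a
    obtain ⟨g, rfl⟩ := oneCocycleClass_surjective X b
    rw [(oneCocycleClass_eq_zero_iff X f).2 (H f.1 f.2), (oneCocycleClass_eq_zero_iff X g).2 (H g.1 g.2)]

variable [LocallyCompactSpace G]

/-- `H²_cont(G, X) = 0` iff every continuous inhomogeneous `2`-cocycle is a continuous coboundary.
[cite: SerreGaloisCohomology1997, I §2.3] -/
theorem subsingleton_continuousCohomology_two_iff_forall_twoCocycle (X : TopRep.{v} R G) :
    Subsingleton (continuousCohomology 2 X) ↔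
      ∀ f : C(G × G, X), (∀ σ τ υ : G, X.ρ σ (f (τ, υ)) + f (σ, τ * υ) = f (σ * τ, υ) + f (σ, τ)) →
        ∃ b : C(G, X), ∀ σ τ : G, f (σ, τ) = X.ρ σ (b τ) - b (σ * τ) + b σ := by
  constructor
  · intro h f hf
    have h0 : twoCocycleClass X ⟨f, hf⟩ = 0 := Subsingleton.elim _ _
    exact (twoCocycleClass_eq_zero_iff X ⟨f, hf⟩).1 h0
  · intro H
    refine ⟨fun a b => ?_⟩
    obtain ⟨f, rfl⟩ := twoCocycleClass_surjective X a
    obtain ⟨g, rfl⟩ := twoCocycleClass_surjective X b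
    rw [(twoCocycleClass_eq_zero_iff X f).2 (H f.1 f.2), (twoCocycleClass_eq_zero_iff X g).2 (H g.1 g.2)]

end Criterion

section RestrictScalars

variable {G : Type u} [Group G] [TopologicalSpace G] [IsTopologicalGroup G]
  (P : Type u) [CommRing P] [TopologicalSpace P]
  {A : Type u} [CommRing A] [TopologicalSpace A] [Algebra P A]
  {M : Type u} [AddCommGroup M] [Module A M] [Module P M] [IsScalarTower P A M]
  [TopologicalSpace M] [IsTopologicalAddGroup M] [ContinuousSMul A M] [ContinuousSMul P M]

/-- **`H¹_cont` does not see the scalars**: `H¹(G, M|_P) = 0 ↔ H¹(G, M) = 0`.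
[cite: SerreGaloisCohomology1997, I §2.2] -/
theorem ContinuousRep.subsingleton_H_one_restrictScalars_iff (ρ : ContinuousRep G A M) :
    Subsingleton ((ρ.restrictScalars P).H 1) ↔ Subsingleton (ρ.H 1) := by
  change Subsingleton (continuousCohomology 1 (ρ.restrictScalars P).toTopRep) ↔
    Subsingleton (continuousCohomology 1 ρ.toTopRep)
  rw [subsingleton_continuousCohomology_one_iff_forall_oneCocycle, subsingleton_continuousCohomology_one_iff_forall_oneCocycle]
  exact Iff.rfl

variable [LocallyCompactSpace G]

/-- **`H²_cont` does not see the scalars**: `H²(G, M|_P) = 0 ↔ H²(G, M) = 0`.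
[cite: SerreGaloisCohomology1997, I §2.3] -/
theorem ContinuousRep.subsingleton_H_two_restrictScalars_iff (ρ : ContinuousRep G A M) :
    Subsingleton ((ρ.restrictScalars P).H 2) ↔ Subsingleton (ρ.H 2) := by
  change Subsingleton (continuousCohomology 2 (ρ.restrictScalars P).toTopRep) ↔
    Subsingleton (continuousCohomology 2 ρ.toTopRep)
  rw [subsingleton_continuousCohomology_two_iff_forall_twoCocycle, subsingleton_continuousCohomology_two_iff_forall_twoCocycle]
  exact Iff.rfl

end RestrictScalars

end Literature.NumberTheory.GaloisRepresentations

end
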